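import Summits.CriticalPhenomena.PercolationContinuityZ3.Theorems.PercNearOneGluingNoHeavyLowerTailSahiE3Relabel
import Summits.CriticalPhenomena.PercolationContinuityZ3.Theorems.PercNearOneGluingNoHeavyLowerTailSahiC3CubeThreeFKGPrelim
import Mathlib.Tactic.Linarith
import HarnessLib
import HarnessLib.Audit

/-!
# `NoHeavyLowerTail` (crux stmt-CriticalPhenomena-4575), Sahi programme P4: coordinate permutations of the cube on set codes

Support file (cell `prim-l12`, seat P4; `--supports stmt-CriticalPhenomena-4575`).  No named facts, no sorries; standard axioms.

The residual-orbit theorems `SahiC3CubeFourFKG.orbit*_nonneg` fix one labelling.  This file supplies the transport to any relabelling at the level of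
set codes: the order automorphism `permIso p` (`x ↦ x ∘ p`) of the cube `Fin m → Bool` induced by a permutation `p` of the coordinates, the bit formula
for the code of a preimage (`testBit_encF_preimage`), and `latticeE3_nonneg_of_perm`: a statement `0 ≤ latticeE3 ν U' A' B'` known for all FKG weights
`ν` and all sets with prescribed codes `(u₀, a₀, b₀)` transfers to every triple `(U, A, B)` whose codes are the `p`-relabelled ones — the relabelling
condition being the decidable bit identity `∀ j < 2^m, (encF m U).testBit (enc2 (ptB m j ∘ p)) = u₀.testBit j` checked by the assembly table
(HOME prim-l12-p4/ASSEMBLY-PLAN-FKG-CUBE4.md).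
-/

namespace Summit.CriticalPhenomena.PercolationContinuityZ3.Theorems.SahiC3CubeFourFKG

open Finset Literature.Probability.LatticeModels SahiC3Cube OneCutCert SahiE3Relabel

variable {m : ℕ}

/-- The order automorphism of the cube induced by a permutation of the coordinates: `x ↦ x ∘ p`. [this work] -/
def permIso (p : Equiv.Perm (Fin m)) : (Fin m → Bool) ≃o (Fin m → Bool) where
  toFun x := x ∘ p
  invFun x := x ∘ p.symm
  left_inv x := funext fun i => by simp
  right_inv x := funext fun i => by simp
  map_rel_iff' := by
    intro x y
    constructor
    · intro h i
      simpa using h (p.symm i)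
    · intro h i
      exact h (p i)

/-- `permIso p x = x ∘ p`. [this work] -/
theorem permIso_apply (p : Equiv.Perm (Fin m)) (x : Fin m → Bool) : permIso p x = x ∘ p := rfl

/-- **Code of a preimage**: bit `j` of the code of `(permIso p)⁻¹(S)` (the set whose `permIso p`-image is `S`) is the bit of `encF m S` at the code of
`ptB m j ∘ p`. [this work] -/
theorem testBit_encF_preimage (p : Equiv.Perm (Fin m)) (S : Finset (Fin m → Bool)) {j : ℕ} (hj : j < 2 ^ m) :
    (encF m (S.map (permIso p).symm.toEquiv.toEmbedding)).testBit j = (encF m S).testBit (enc2 (ptB m j ∘ p)) := by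
  have h1 : (encF m (S.map (permIso p).symm.toEquiv.toEmbedding)).testBit j = decide (ptB m j ∈ S.map (permIso p).symm.toEquiv.toEmbedding) := by
    rw [testBit_encF]; simp [hj]
  have h2 : ptB m j ∈ S.map (permIso p).symm.toEquiv.toEmbedding ↔ ptB m j ∘ p ∈ S := by
    rw [Finset.mem_map_equiv]; rfl
  rw [h1]
  by_cases h : ptB m j ∘ p ∈ S
  · rw [decide_eq_true (h2.2 h), ((mem_iff_testBit_encF S _).1 h)]
  · rw [decide_eq_false (fun h' => h (h2.1 h'))]
    symm
    exact Bool.eq_false_iff.2 fun h' => h ((mem_iff_testBit_encF S _).2 h')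

/-- The image of the preimage is the set. [folklore] -/
theorem map_map_symm_permIso (p : Equiv.Perm (Fin m)) (S : Finset (Fin m → Bool)) :
    (S.map (permIso p).symm.toEquiv.toEmbedding).map (permIso p).toEquiv.toEmbedding = S := by
  rw [Finset.map_map]
  convert Finset.map_refl (s := S) using 2
  ext x
  simp

/-- From the bit identity checked by the table to the code of the preimage. [this work] -/
theorem encF_preimage_eq (p : Equiv.Perm (Fin m)) {S : Finset (Fin m → Bool)} {s₀ : ℕ} (hs₀ : s₀ < 2 ^ (2 ^ m))
    (h : ∀ j < 2 ^ m, (encF m S).testBit (enc2 (ptB m j ∘ p)) = s₀.testBit j) :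
    encF m (S.map (permIso p).symm.toEquiv.toEmbedding) = s₀ := by
  refine Nat.eq_of_testBit_eq fun j => ?_
  by_cases hj : j < 2 ^ m
  · rw [testBit_encF_preimage p S hj, h j hj]
  · have hle : 2 ^ (2 ^ m) ≤ 2 ^ j := Nat.pow_le_pow_right (by norm_num) (not_lt.1 hj)
    rw [Nat.testBit_lt_two_pow (lt_of_lt_of_le (encF_lt m _) hle), Nat.testBit_lt_two_pow (lt_of_lt_of_le hs₀ hle)]

/-- **Residual-orbit transport**: if `0 ≤ latticeE3 ν U' A' B'` for every nonnegative log-supermodular `ν` and all sets with codes `(u₀, a₀, b₀)`,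
then `0 ≤ latticeE3 μ U A B` for every nonnegative log-supermodular `μ` and every triple whose codes are the `p`-relabelling of `(u₀, a₀, b₀)`
(bit identities). [this work] -/
theorem latticeE3_nonneg_of_perm (p : Equiv.Perm (Fin m)) {u₀ a₀ b₀ : ℕ} (hu₀ : u₀ < 2 ^ (2 ^ m)) (ha₀ : a₀ < 2 ^ (2 ^ m)) (hb₀ : b₀ < 2 ^ (2 ^ m))
    (horb : ∀ ν : (Fin m → Bool) → ℝ, 0 ≤ ν → (∀ a b, ν a * ν b ≤ ν (a ⊓ b) * ν (a ⊔ b)) →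
      ∀ U' A' B' : Finset (Fin m → Bool), encF m U' = u₀ → encF m A' = a₀ → encF m B' = b₀ → 0 ≤ latticeE3 ν U' A' B')
    {μ : (Fin m → Bool) → ℝ} (hμ₀ : 0 ≤ μ) (hμ : ∀ a b, μ a * μ b ≤ μ (a ⊓ b) * μ (a ⊔ b)) {U A B : Finset (Fin m → Bool)}
    (hU : ∀ j < 2 ^ m, (encF m U).testBit (enc2 (ptB m j ∘ p)) = u₀.testBit j)
    (hA : ∀ j < 2 ^ m, (encF m A).testBit (enc2 (ptB m j ∘ p)) = a₀.testBit j)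
    (hB : ∀ j < 2 ^ m, (encF m B).testBit (enc2 (ptB m j ∘ p)) = b₀.testBit j) : 0 ≤ latticeE3 μ U A B := by
  rw [← map_map_symm_permIso p U, ← map_map_symm_permIso p A, ← map_map_symm_permIso p B, latticeE3_map_equiv]
  exact horb _ (nonneg_comp_orderIso (permIso p) hμ₀) (lsm_comp_orderIso (permIso p) hμ) _ _ _
    (encF_preimage_eq p hu₀ hU) (encF_preimage_eq p ha₀ hA) (encF_preimage_eq p hb₀ hB)

end Summit.CriticalPhenomena.PercolationContinuityZ3.Theorems.SahiC3CubeFourFKG
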